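import Literature.AlgebraicGeometry.Motives.FiniteQuotientQuasiProjective
import Literature.AlgebraicGeometry.Motives.SepQuotientComparisonComplex
import Literature.AlgebraicGeometry.Motives.BijectiveMorphismIsoGeneral
import Mathlib.AlgebraicGeometry.Morphisms.Proper
import HarnessLib

/-!
# Recognising a morphism as the quotient by a finite group at NON-PROPER levels

Topic `AlgebraicGeometry/Motives`; namespace `Literature.AlgebraicGeometry.Motives`.  THEOREMS ONLY (no definition, no named
fact, no instance).

Setting: `k` a field, `Y` a separated `k`-scheme, `G` a finite group acting by `k`-automorphisms (`ρ : ActionOver Y.hom G`) whose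
`G`-stable affine opens cover `Y` (Mumford's hypothesis `hcov`; e.g. `Y` quasi-projective — NOT necessarily proper), `π : Y ⟶ Y/G`
the tree's quotient map (`Motives.finiteQuotient.mk`, Mumford, *Abelian Varieties* §7 Thm. p. 66; SGA 1 V §1), `Z` a separated
`k`-scheme and `f : Y ⟶ Z` a `G`-INVARIANT `k`-morphism, with its descent `r := finiteQuotient.desc ρ hcov f hf : Y/G ⟶ Z`
(`π ≫ r = f`).  The problem (the tree's `SepQuotientComparisonComplex.lean`, there for PROJECTIVE `Y`): decide that `f` IS the quotient,
`IsSepQuotient (fun g => act g) f`.  Answer: `f = π ≫ r` and `f` is the quotient iff `r` is an isomorphism (`IsSepQuotient.of_comp_iso`);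
WITHOUT properness of `Y` the isomorphism is recognised from (a) `r` PROPER — inherited from `f` through the surjection `π` — and
(b) `r` bijective on complex points — i.e. `f(ℂ)` onto with fibres single orbits — by the relative Zariski-Main-Theorem corollary
`isIso_of_bijective_of_isProper(_of_smooth)` (`Motives/BijectiveMorphismIsoGeneral.lean`, [Springer1998] Thm. 5.2.8, [GortzWedhorn2020]
Cor. 12.88), piece by piece when the target is a coproduct of integral pieces.

* §1 (`k` any field) the DESCENDED MORPHISM `r`: `finiteQuotient.mk_left_comp_desc_left`, `surjective_mk_left`,
  **`universallyClosed_desc_left`** (Mathlib `UniversallyClosed.of_comp_surjective`), `surjective_desc_left`, `isSeparated_desc_left`,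
  `locallyOfFiniteType_desc_left`, **`isProper_desc_left`** (`f` proper ⇒ `r` proper).
* §2 (over `ℂ`) complex points of `r`: `map_desc_map_mk`, `map_pointsAction_of_invariant`, **`surjective_map_desc_iff`**,
  **`injective_map_desc_iff`** (injective ⇔ fibres of `f(ℂ)` are single `G`-orbits), **`bijective_map_desc_iff`** (SGA 1 V Prop. 1.1).
* §3 (over `ℂ`) **`isIso_of_bijective_of_isColimit_cofan_of_isProper`** — the non-proper-SOURCE twin of the tree's
  `isIso_of_bijective_of_isColimit_cofan`: `r : Q ⟶ M` PROPER (instead of `Q` proper), `Q` reduced and locally of finite type, `M` the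
  coproduct of SMOOTH INTEGRAL pieces (colimit cofan), `r` bijective on complex points ⇒ `r` is an isomorphism (per piece: base change
  of `r` is proper, reduced source, bijective, so `isIso_of_bijective_of_isProper_of_smooth`; «isomorphism» is Zariski-local on `M`).
* §4 (over `ℂ`) RECOGNITION: **`isSepQuotient_of_isProper_of_bijective`** (target smooth integral) and
  **`isSepQuotient_of_isProper_of_isColimit_cofan`** (target a coproduct of smooth integral pieces): `act : Δ →* Aut_ℂ(Y)`, `Y` separated
  reduced locally of finite type with Mumford cover, `f : Y ⟶ Z` `Δ`-invariant with `f.left` PROPER, `f(ℂ)` onto with fibres single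
  `Δ`-orbits ⇒ `IsSepQuotient (fun g => act g) f`.

Use (cell `hodgecm-mathlib`, fan B, rung B-I; HOME memo `B-provers/B-p06/CENSUS-M2-nonproper-quotients.md`): the level transitions
`p : Mc_{K′} ⟶ Mc_K` of the quasi-projective Siegel tower (MUMFORD-LINE-SPEC §4 «transitions», [Deligne1971TravauxShimura] 1.8, 4.16) —
finite étale hence proper, with `Sh_K(ℂ) = Sh_{K′}(ℂ)/(K/K′)` on points and `Mc_K` a finite coproduct of smooth integral pieces — are
quotient maps by `K/K′`.  HC_CM is proved only modulo the 7 printed citations until rung 0 of the ladder closes; this file is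
unconditional and Shimura-free.

## References
* [MumfordAV1970] D. Mumford, *Abelian Varieties* (1970), §7 Theorem p. 66 (1), (2) and Remark (categorical quotient).
* [SGA1] A. Grothendieck, M. Raynaud, *SGA 1*, Exp. V §1, Prop. 1.1 (`π` surjective, fibres = orbits), Cor. 1.5, Prop. 1.8.
* [Springer1998] T. A. Springer, *Linear Algebraic Groups* (2nd ed.), Thm. 5.2.8 (bijective birational onto normal ⇒ iso).
* [GortzWedhorn2020] U. Görtz, T. Wedhorn, *Algebraic Geometry I* (2nd ed.), Cor. 12.88; §(3.5) Example 3.11 (disjoint unions).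
* [StacksProject] Tag 01W0 (universally closed morphisms).
-/

noncomputable section

open CategoryTheory CategoryTheory.Limits AlgebraicGeometry
open Literature.AlgebraicGeometry.RelativeSpec

namespace Literature.AlgebraicGeometry.Motives

universe u

/-! ### §1 Scheme-level properties of the descended morphism -/

section Scheme

variable {k : Type u} [Field k] {Y : SchemeOver k} {G : Type*} [Group G] [Finite G]
  (ρ : ActionOver Y.hom G) [IsSeparated Y.hom] (hcov : ∀ y : Y.left, ∃ O : ρ.StableAffineOpens, y ∈ O.1)
  {Z : SchemeOver k} [Z.left.IsSeparated] (f : Y ⟶ Z) (hf : ∀ g : G, (ρ.overIso g).hom ≫ f = f)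

/-- `π ≫ r = f` on underlying schemes. [cite: MumfordAV1970, §7 Thm. p. 66 (Remark)] -/
@[reassoc]
theorem finiteQuotient.mk_left_comp_desc_left :
    (finiteQuotient.mk ρ hcov).left ≫ (finiteQuotient.desc ρ hcov f hf).left = f.left := by
  rw [← Over.comp_left, finiteQuotient.mk_desc]

/-- `π : Y ⟶ Y/G` is surjective, as an instance of Mathlib's `Surjective` class. [cite: SGA1, Exp. V, Prop. 1.1] -/
theorem finiteQuotient.surjective_mk_left : Surjective (finiteQuotient.mk ρ hcov).left :=
  ⟨finiteQuotient.mk_left_surjective ρ hcov⟩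

/-- **`r : Y/G ⟶ Z` is universally closed when `f` is**: closedness (after any base change) descends along the surjection `π`
(Mathlib `UniversallyClosed.of_comp_surjective`). [cite: StacksProject, Tag 01W0] [cite: SGA1, Exp. V, Prop. 1.1] -/
theorem finiteQuotient.universallyClosed_desc_left [UniversallyClosed f.left] :
    UniversallyClosed (finiteQuotient.desc ρ hcov f hf).left := by
  haveI := finiteQuotient.surjective_mk_left ρ hcov
  haveI : UniversallyClosed ((finiteQuotient.mk ρ hcov).left ≫ (finiteQuotient.desc ρ hcov f hf).left) := by
    rw [finiteQuotient.mk_left_comp_desc_left]; infer_instance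
  exact UniversallyClosed.of_comp_surjective (finiteQuotient.mk ρ hcov).left _

/-- **`r : Y/G ⟶ Z` is surjective when `f` is.** [cite: SGA1, Exp. V, Prop. 1.1] -/
theorem finiteQuotient.surjective_desc_left [Surjective f.left] :
    Surjective (finiteQuotient.desc ρ hcov f hf).left := by
  haveI : Surjective ((finiteQuotient.mk ρ hcov).left ≫ (finiteQuotient.desc ρ hcov f hf).left) := by
    rw [finiteQuotient.mk_left_comp_desc_left]; infer_instance
  exact Surjective.of_comp (finiteQuotient.mk ρ hcov).left _

/-- `r : Y/G ⟶ Z` is separated (`Y/G → Spec k` is, and `r ≫ (Z → Spec k) = (Y/G → Spec k)`). [cite: MumfordAV1970, §7 Thm. p. 66] -/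
theorem finiteQuotient.isSeparated_desc_left : IsSeparated (finiteQuotient.desc ρ hcov f hf).left := by
  haveI : IsSeparated ((finiteQuotient.desc ρ hcov f hf).left ≫ Z.hom) := by
    rw [Over.w]; exact isSeparated_finiteQuotient_hom ρ hcov
  exact IsSeparated.of_comp _ Z.hom

/-- `r : Y/G ⟶ Z` is locally of finite type for `Y` locally of finite type over `k`. [cite: SGA1, Exp. V, Cor. 1.5] -/
theorem finiteQuotient.locallyOfFiniteType_desc_left [LocallyOfFiniteType Y.hom] :
    LocallyOfFiniteType (finiteQuotient.desc ρ hcov f hf).left := by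
  haveI : LocallyOfFiniteType ((finiteQuotient.desc ρ hcov f hf).left ≫ Z.hom) := by
    rw [Over.w]; exact locallyOfFiniteType_finiteQuotient_hom ρ
  exact locallyOfFiniteType_of_comp _ Z.hom

/-- **`r : Y/G ⟶ Z` is PROPER when `f` is** (and `Y` is locally of finite type over `k`): separated and locally of finite type by
cancellation, universally closed by descent along the surjective `π`. [cite: StacksProject, Tag 01W0] [cite: SGA1, Exp. V, Prop. 1.1 and Cor. 1.5] -/
theorem finiteQuotient.isProper_desc_left [LocallyOfFiniteType Y.hom] [IsProper f.left] :
    IsProper (finiteQuotient.desc ρ hcov f hf).left := by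
  haveI := finiteQuotient.universallyClosed_desc_left ρ hcov f hf
  haveI := finiteQuotient.isSeparated_desc_left ρ hcov f hf
  haveI := finiteQuotient.locallyOfFiniteType_desc_left ρ hcov f hf
  exact {}

end Scheme

/-! ### §2 Complex points of the descended morphism -/

section Points

variable {Y : SchemeOver ℂ} {G : Type} [Group G] [Finite G] (ρ : ActionOver Y.hom G) [IsSeparated Y.hom]
  (hcov : ∀ y : Y.left, ∃ O : ρ.StableAffineOpens, y ∈ O.1)
  {Z : SchemeOver ℂ} [Z.left.IsSeparated] (f : Y ⟶ Z) (hf : ∀ g : G, (ρ.overIso g).hom ≫ f = f)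

/-- `r(π(P)) = f(P)` on complex points. [cite: MumfordAV1970, §7 Thm. p. 66 (Remark)] -/
theorem finiteQuotient.map_desc_map_mk (P : ComplexPoints Y) :
    AlgPoints.map (finiteQuotient.desc ρ hcov f hf) (AlgPoints.map (finiteQuotient.mk ρ hcov) P) = AlgPoints.map f P := by
  rw [← AlgPoints.map_comp_apply, finiteQuotient.mk_desc]

include hf in
omit [Finite G] [IsSeparated Y.hom] [Z.left.IsSeparated] in
/-- `f(ℂ)` is constant on `G`-orbits. [cite: MumfordAV1970, §7 Thm. p. 66 (1)] -/
theorem finiteQuotient.map_pointsAction_of_invariant (g : G) (P : ComplexPoints Y) :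
    AlgPoints.map f (pointsAction ρ g P) = AlgPoints.map f P := by
  rw [pointsAction_apply, ← AlgPoints.map_comp_apply, hf g]

/-- **`r(ℂ)` is onto iff `f(ℂ)` is onto** (`π(ℂ)` is onto for `Y` locally of finite type). [cite: SGA1, Exp. V, Prop. 1.1] -/
theorem finiteQuotient.surjective_map_desc_iff [LocallyOfFiniteType Y.hom] :
    Function.Surjective (AlgPoints.map (L := ℂ) (finiteQuotient.desc ρ hcov f hf)) ↔
      Function.Surjective (AlgPoints.map (L := ℂ) f) := by
  constructor
  · intro h z
    obtain ⟨q, hq⟩ := h z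
    obtain ⟨P, rfl⟩ := map_mk_surjective ρ hcov q
    exact ⟨P, by rw [← finiteQuotient.map_desc_map_mk ρ hcov f hf, hq]⟩
  · intro h z
    obtain ⟨P, hP⟩ := h z
    exact ⟨AlgPoints.map (finiteQuotient.mk ρ hcov) P, by rw [finiteQuotient.map_desc_map_mk, hP]⟩

/-- **`r(ℂ)` is injective iff the fibres of `f(ℂ)` are single `G`-orbits** (the fibres of `π(ℂ)` are the orbits).
[cite: SGA1, Exp. V, Prop. 1.1] -/
theorem finiteQuotient.injective_map_desc_iff [LocallyOfFiniteType Y.hom] :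
    Function.Injective (AlgPoints.map (L := ℂ) (finiteQuotient.desc ρ hcov f hf)) ↔
      ∀ P Q : ComplexPoints Y, AlgPoints.map f P = AlgPoints.map f Q → ∃ g : G, pointsAction ρ g P = Q := by
  constructor
  · intro h P Q hPQ
    refine exists_pointsAction_eq_of_map_mk_eq ρ hcov (h ?_)
    rw [finiteQuotient.map_desc_map_mk, finiteQuotient.map_desc_map_mk, hPQ]
  · intro h q₁ q₂ hq
    obtain ⟨P₁, rfl⟩ := map_mk_surjective ρ hcov q₁
    obtain ⟨P₂, rfl⟩ := map_mk_surjective ρ hcov q₂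
    rw [finiteQuotient.map_desc_map_mk, finiteQuotient.map_desc_map_mk] at hq
    obtain ⟨g, rfl⟩ := h P₁ P₂ hq
    rw [map_mk_pointsAction]

/-- **`r(ℂ) : (Y/G)(ℂ) → Z(ℂ)` is bijective iff `f(ℂ)` is onto and its fibres are single `G`-orbits** — the point-set input under
which a Zariski-Main-Theorem statement recognises `r` as an isomorphism and `f` as the quotient map. [cite: SGA1, Exp. V, Prop. 1.1] -/
theorem finiteQuotient.bijective_map_desc_iff [LocallyOfFiniteType Y.hom] :
    Function.Bijective (AlgPoints.map (L := ℂ) (finiteQuotient.desc ρ hcov f hf)) ↔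
      Function.Surjective (AlgPoints.map (L := ℂ) f) ∧
        ∀ P Q : ComplexPoints Y, AlgPoints.map f P = AlgPoints.map f Q → ∃ g : G, pointsAction ρ g P = Q := by
  rw [Function.Bijective, finiteQuotient.injective_map_desc_iff, finiteQuotient.surjective_map_desc_iff, and_comm]

end Points

/-! ### §3 Bijective PROPER morphisms onto a coproduct of smooth integral pieces are isomorphisms -/

section Pieces

variable {Q M : SchemeOver ℂ} (r : Q ⟶ M) {κ : Type} {X : κ → SchemeOver ℂ} (ι : ∀ q, X q ⟶ M)

/-- **A PROPER `ℂ`-morphism `r : Q → M = ∐_q X_q`, `Q` reduced and locally of finite type, `X_q` smooth and integral, bijective on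
complex points, is an isomorphism** — the non-proper-source twin of `isIso_of_bijective_of_isColimit_cofan` (there `Q` proper, `X_q`
smooth projective).  Over each piece the base change `r_q : Q ×_M X_q → X_q` of `r` is proper, its source is reduced (open in `Q`) and
locally of finite type, and it is bijective on complex points (the complex points of `Q ×_M X_q` are the pairs `(a, x)` with
`r a = ι_q x`), hence an isomorphism by the relative Zariski-Main-Theorem form `isIso_of_bijective_of_isProper_of_smooth`; and
«isomorphism» is Zariski-local on `M`, which the open immersions `ι_q` cover (Mathlib `IsZariskiLocalAtTarget.of_openCover`).
[cite: Springer1998, Thm. 5.2.8 (p. 85)] [cite: GortzWedhorn2020, Cor. 12.88; §(3.5) Example 3.11] -/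
theorem isIso_of_bijective_of_isColimit_cofan_of_isProper [IsProper r.left] [IsReduced Q.left] [LocallyOfFiniteType Q.hom]
    [∀ q, Smooth (X q).hom] [∀ q, IsIntegral (X q).left] (hcol : IsColimit (Cofan.mk M ι))
    (hr : Function.Bijective (AlgPoints.map (L := ℂ) r)) : IsIso r := by
  obtain ⟨hcol'⟩ := Literature.AlgebraicGeometry.Morphisms.isColimit_cofan_left hcol
  haveI hιo : ∀ q, IsOpenImmersion (ι q).left := fun q =>
    Literature.AlgebraicGeometry.Morphisms.isOpenImmersion_of_isColimit_cofan hcol' q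
  haveI : LocallyOfFiniteType r.left := by
    have h : LocallyOfFiniteType (r.left ≫ M.hom) := by rw [Over.w r]; infer_instance
    exact locallyOfFiniteType_of_comp r.left M.hom
  -- the open cover of `M` by the pieces
  let 𝒰 : M.left.OpenCover := Scheme.Cover.mkOfCovers κ (fun q => (X q).left) (fun q => (ι q).left)
    (fun m => Literature.AlgebraicGeometry.Morphisms.exists_eq_of_isColimit_cofan hcol' m)
  -- over each piece the base change of `r` is an isomorphism
  have hpiece : ∀ q, IsIso (pullback.snd r.left (ι q).left) := by
    intro q
    -- the pulled-back piece `Q_q = Q ×_M X_q` over `ℂ` and `r_q : Q_q → X_q`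
    let Qq : SchemeOver ℂ := Over.mk (pullback.snd r.left (ι q).left ≫ (X q).hom)
    let rq : Qq ⟶ X q := Over.homMk (pullback.snd r.left (ι q).left) rfl
    haveI : IsProper rq.left := by
      change IsProper (pullback.snd r.left (ι q).left)
      infer_instance
    haveI : LocallyOfFiniteType Qq.hom := by
      change LocallyOfFiniteType (pullback.snd r.left (ι q).left ≫ (X q).hom)
      infer_instance
    haveI : IsReduced Qq.left := by
      change IsReduced (pullback r.left (ι q).left)
      exact isReduced_of_isOpenImmersion (pullback.fst r.left (ι q).left)
    -- a map `Spec ℂ → Q ×_M X_q` over `X_q` gives a complex point of `Q`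
    have hw : ∀ l : Spec (CommRingCat.of ℂ) ⟶ pullback r.left (ι q).left,
        l ≫ pullback.snd r.left (ι q).left ≫ (X q).hom = (specOver ℂ ℂ).hom →
        (l ≫ pullback.fst r.left (ι q).left) ≫ Q.hom = (specOver ℂ ℂ).hom := by
      intro l hl
      rw [← Over.w r, Category.assoc, pullback.condition_assoc, Over.w (ι q)]
      exact hl
    have hbij : Function.Bijective (AlgPoints.map (L := ℂ) rq) := by
      constructor
      · intro x₁ x₂ h₁₂
        let l₁ : Spec (CommRingCat.of ℂ) ⟶ pullback r.left (ι q).left := x₁.left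
        let l₂ : Spec (CommRingCat.of ℂ) ⟶ pullback r.left (ι q).left := x₂.left
        have hsnd : l₁ ≫ pullback.snd r.left (ι q).left = l₂ ≫ pullback.snd r.left (ι q).left :=
          congrArg (fun P : AlgPoints (X q) ℂ => P.left) h₁₂
        have hfst : l₁ ≫ pullback.fst r.left (ι q).left = l₂ ≫ pullback.fst r.left (ι q).left := by
          have h := @hr.1 (Over.homMk (l₁ ≫ pullback.fst r.left (ι q).left) (hw l₁ (Over.w x₁)))
            (Over.homMk (l₂ ≫ pullback.fst r.left (ι q).left) (hw l₂ (Over.w x₂))) (Over.OverMorphism.ext (by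
              change (l₁ ≫ pullback.fst r.left (ι q).left) ≫ r.left = (l₂ ≫ pullback.fst r.left (ι q).left) ≫ r.left
              rw [Category.assoc, Category.assoc, pullback.condition, ← Category.assoc, ← Category.assoc, hsnd]))
          exact congrArg (fun P : AlgPoints Q ℂ => P.left) h
        exact Over.OverMorphism.ext (pullback.hom_ext hfst hsnd)
      · intro x
        obtain ⟨a, ha⟩ := hr.2 (AlgPoints.map (ι q) x)
        let la : Spec (CommRingCat.of ℂ) ⟶ Q.left := a.left
        let lx : Spec (CommRingCat.of ℂ) ⟶ (X q).left := x.left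
        have hax : la ≫ r.left = lx ≫ (ι q).left := congrArg (fun P : AlgPoints M ℂ => P.left) ha
        refine ⟨Over.homMk (pullback.lift la lx hax) ?_, ?_⟩
        · change pullback.lift la lx hax ≫ pullback.snd r.left (ι q).left ≫ (X q).hom = (specOver ℂ ℂ).hom
          rw [pullback.lift_snd_assoc]
          exact Over.w x
        · exact Over.OverMorphism.ext (pullback.lift_snd la lx hax)
    haveI : IsIso rq := isIso_of_bijective_of_isProper_of_smooth rq hbij
    exact inferInstanceAs (IsIso ((Over.forget _).map rq))
  -- «isomorphism» is Zariski-local on the target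
  have hleft : (MorphismProperty.isomorphisms Scheme.{0}) r.left :=
    IsZariskiLocalAtTarget.of_openCover 𝒰 fun q => (MorphismProperty.isomorphisms.iff _).2 (hpiece q)
  haveI : IsIso r.left := (MorphismProperty.isomorphisms.iff _).1 hleft
  haveI : IsIso ((Over.forget _).map r) := inferInstanceAs (IsIso r.left)
  exact isIso_of_reflects_iso r (Over.forget _)

end Pieces

/-! ### §4 Recognising `f : Y ⟶ Z` as the quotient map, `Y` NOT assumed proper -/

section Recognition

variable {Δ : Type} [Group Δ] [Finite Δ] {Y Z : SchemeOver ℂ} [IsSeparated Y.hom] [LocallyOfFiniteType Y.hom]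
  [IsReduced Y.left] (act : Δ →* Aut Y) (f : Y ⟶ Z)

/-- A `k`-scheme with separated structure map is a separated scheme. [folklore] -/
private theorem isSeparated_left_of_isSeparated_hom'' (W : SchemeOver ℂ) (hW : IsSeparated W.hom) :
    W.left.IsSeparated :=
  ⟨by rw [← terminal.comp_from W.hom]; infer_instance⟩

omit [Finite Δ] [IsSeparated Y.hom] [LocallyOfFiniteType Y.hom] [IsReduced Y.left] in
/-- The inline `ActionOver` of `act` has `overIso g = act g`, so `f` is invariant in the `ActionOver` spelling. [folklore] -/
private theorem forall_overIso_hom_comp_eq_of_forall_hom_comp_eq (hinv : ∀ g : Δ, (act g).hom ≫ f = f) (g : Δ) :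
    ((⟨((Over.forget _).mapAut Y).comp act, fun g => Over.w (act g).hom⟩ : ActionOver Y.hom Δ).overIso g).hom ≫ f = f := by
  have hov : ((⟨((Over.forget _).mapAut Y).comp act, fun g => Over.w (act g).hom⟩ : ActionOver Y.hom Δ).overIso g).hom =
      (act g).hom := Over.OverMorphism.ext rfl
  rw [hov]; exact hinv g

/-- **The comparison data at non-proper levels.**  For `act : Δ →* Aut_ℂ(Y)` (`Δ` finite) on the separated, reduced,
locally-of-finite-type `Y` whose `Δ`-stable affine opens cover it, and a `Δ`-invariant `f : Y ⟶ Z` to a separated `Z`: there are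
`π : Y ⟶ Q` (the quotient `Y/Δ`, a quotient for separated test objects, `Q` reduced and locally of finite type) and `r : Q ⟶ Z` with
`π ≫ r = f`, `r` PROPER if `f` is, and `r(ℂ)` bijective iff `f(ℂ)` is onto with fibres single `Δ`-orbits (§1, §2 over the tree's
`finiteQuotient`). [cite: MumfordAV1970, §7 Thm. p. 66 (1), (2) and Remark] [cite: SGA1, Exp. V §1 Prop. 1.1, 1.8] -/
theorem exists_quotient_comparison
    (hcov : ∀ y : Y.left, ∃ O : (⟨((Over.forget _).mapAut Y).comp act, fun g => Over.w (act g).hom⟩ :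
      ActionOver Y.hom Δ).StableAffineOpens, y ∈ O.1)
    (hinv : ∀ g : Δ, (act g).hom ≫ f = f) [IsSeparated Z.hom] :
    ∃ (Q : SchemeOver ℂ) (π : Y ⟶ Q) (r : Q ⟶ Z), π ≫ r = f ∧ IsSepQuotient (fun g => act g) π ∧
      IsReduced Q.left ∧ LocallyOfFiniteType Q.hom ∧ (IsProper f.left → IsProper r.left) ∧
      (Function.Bijective (AlgPoints.map (L := ℂ) r) ↔
        Function.Surjective (AlgPoints.map (L := ℂ) f) ∧
          ∀ P P' : ComplexPoints Y, AlgPoints.map f P = AlgPoints.map f P' → ∃ g : Δ, AlgPoints.map (act g).hom P = P') := by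
  haveI : Z.left.IsSeparated := isSeparated_left_of_isSeparated_hom'' Z inferInstance
  have hinv' := forall_overIso_hom_comp_eq_of_forall_hom_comp_eq act f hinv
  -- the quotient `π` and the descended `r`, written over an opaque `ρ` with its defining equation
  obtain ⟨ρ, hρ⟩ : ∃ ρ : ActionOver Y.hom Δ,
      ρ = ⟨((Over.forget _).mapAut Y).comp act, fun g => Over.w (act g).hom⟩ := ⟨_, rfl⟩
  have hcovρ : ∀ y : Y.left, ∃ O : ρ.StableAffineOpens, y ∈ O.1 := by subst hρ; exact hcov
  have hinvρ : ∀ g : Δ, (ρ.overIso g).hom ≫ f = f := by subst hρ; exact hinv'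
  have hπ : IsSepQuotient (fun g => act g) (finiteQuotient.mk ρ hcovρ) := by
    subst hρ; exact isSepQuotient_finiteQuotientMk act hcov
  have hactρ : ∀ (g : Δ) (P : ComplexPoints Y), pointsAction ρ g P = AlgPoints.map (act g).hom P := by
    intro g P; subst hρ
    rw [pointsAction_apply]
    exact congrArg (fun φ => AlgPoints.map φ P) (Over.OverMorphism.ext rfl)
  refine ⟨finiteQuotient ρ, finiteQuotient.mk ρ hcovρ, finiteQuotient.desc ρ hcovρ f hinvρ, finiteQuotient.mk_desc ρ hcovρ f hinvρ,
    hπ, isReduced_finiteQuotient_left ρ hcovρ, locallyOfFiniteType_finiteQuotient_hom ρ,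
    fun _ => finiteQuotient.isProper_desc_left ρ hcovρ f hinvρ, ?_⟩
  rw [finiteQuotient.bijective_map_desc_iff ρ hcovρ f hinvρ]
  refine and_congr Iff.rfl (forall_congr' fun P => forall_congr' fun P' => imp_congr_right fun _ => ?_)
  refine exists_congr fun g => ?_
  rw [hactρ]

omit [Finite Δ] [IsSeparated Y.hom] [LocallyOfFiniteType Y.hom] [IsReduced Y.left] in
/-- `IsSepQuotient` from the comparison data once `r` is an isomorphism (`f = π ≫ r`, `IsSepQuotient.of_comp_iso`).
[cite: MumfordAV1970, §7 Thm. p. 66 (Remark)] -/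
theorem isSepQuotient_of_comp_eq_of_isIso {Q : SchemeOver ℂ} {π : Y ⟶ Q} {r : Q ⟶ Z} (hπr : π ≫ r = f)
    (hπ : IsSepQuotient (fun g => act g) π) [IsIso r] : IsSepQuotient (fun g => act g) f := by
  have e : π = f ≫ inv r := by rw [IsIso.eq_comp_inv, hπr]
  refine IsSepQuotient.of_comp_iso (asIso r).symm ?_
  rw [Iso.symm_hom, asIso_inv, ← e]
  exact hπ

/-- **Quotient recognition at non-proper levels, smooth integral target.**  `act : Δ →* Aut_ℂ(Y)` (`Δ` finite) on the separated,
reduced, locally-of-finite-type `Y` whose `Δ`-stable affine opens cover it; `f : Y ⟶ Z` a `Δ`-invariant `ℂ`-morphism with `f.left`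
PROPER onto a smooth, integral, separated `Z`; `f(ℂ)` onto with fibres single `Δ`-orbits.  Then `f` is a quotient of `Y` by `Δ` for
separated test objects.  Proof: `f = π ≫ r`; `r` is proper (§1), `Y/Δ` is reduced ([MumfordAV1970] §7 Thm. (2)) and locally of finite type,
`r` is bijective on complex points (§2), so `r` is an isomorphism (`isIso_of_bijective_of_isProper_of_smooth`), and `π` is a quotient
(`isSepQuotient_finiteQuotientMk`). [cite: MumfordAV1970, §7 Thm. p. 66 (Remark)] [cite: SGA1, Exp. V §1 Prop. 1.1, 1.8]
[cite: Springer1998, Thm. 5.2.8 (p. 85)] -/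
theorem isSepQuotient_of_isProper_of_bijective
    (hcov : ∀ y : Y.left, ∃ O : (⟨((Over.forget _).mapAut Y).comp act, fun g => Over.w (act g).hom⟩ :
      ActionOver Y.hom Δ).StableAffineOpens, y ∈ O.1)
    (hinv : ∀ g : Δ, (act g).hom ≫ f = f) [IsProper f.left] [IsIntegral Z.left] [IsSeparated Z.hom] [Smooth Z.hom]
    (hsurj : Function.Surjective (AlgPoints.map (L := ℂ) f))
    (horb : ∀ P P' : ComplexPoints Y, AlgPoints.map f P = AlgPoints.map f P' → ∃ g : Δ, AlgPoints.map (act g).hom P = P') :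
    IsSepQuotient (fun g => act g) f := by
  obtain ⟨Q, π, r, hπr, hπ, hQred, hQft, hproper, hbij⟩ := exists_quotient_comparison act f hcov hinv
  haveI := hQred; haveI := hQft; haveI := hproper inferInstance
  haveI : IsIso r := isIso_of_bijective_of_isProper_of_smooth r (hbij.2 ⟨hsurj, horb⟩)
  exact isSepQuotient_of_comp_eq_of_isIso act f hπr hπ

/-- **Quotient recognition at non-proper levels, target a coproduct of smooth integral pieces** (the shape of a Shimura level
`Mc_K = ∐_q Γ_q∖X⁺`): as `isSepQuotient_of_isProper_of_bijective`, with `Z` separated and the colimit of a cofan of smooth integral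
`ℂ`-schemes; the isomorphism step is §3 `isIso_of_bijective_of_isColimit_cofan_of_isProper`.
[cite: MumfordAV1970, §7 Thm. p. 66 (Remark)] [cite: SGA1, Exp. V §1 Prop. 1.1, 1.8] [cite: Springer1998, Thm. 5.2.8 (p. 85)]
[cite: GortzWedhorn2020, §(3.5) Example 3.11] -/
theorem isSepQuotient_of_isProper_of_isColimit_cofan
    (hcov : ∀ y : Y.left, ∃ O : (⟨((Over.forget _).mapAut Y).comp act, fun g => Over.w (act g).hom⟩ :
      ActionOver Y.hom Δ).StableAffineOpens, y ∈ O.1)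
    (hinv : ∀ g : Δ, (act g).hom ≫ f = f) [IsProper f.left] [IsSeparated Z.hom]
    {κ : Type} {X : κ → SchemeOver ℂ} (ι : ∀ q, X q ⟶ Z) [∀ q, Smooth (X q).hom] [∀ q, IsIntegral (X q).left]
    (hcol : IsColimit (Cofan.mk Z ι))
    (hsurj : Function.Surjective (AlgPoints.map (L := ℂ) f))
    (horb : ∀ P P' : ComplexPoints Y, AlgPoints.map f P = AlgPoints.map f P' → ∃ g : Δ, AlgPoints.map (act g).hom P = P') :
    IsSepQuotient (fun g => act g) f := by
  obtain ⟨Q, π, r, hπr, hπ, hQred, hQft, hproper, hbij⟩ := exists_quotient_comparison act f hcov hinv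
  haveI := hQred; haveI := hQft; haveI := hproper inferInstance
  haveI : IsIso r := isIso_of_bijective_of_isColimit_cofan_of_isProper r ι hcol (hbij.2 ⟨hsurj, horb⟩)
  exact isSepQuotient_of_comp_eq_of_isIso act f hπr hπ

end Recognition

end Literature.AlgebraicGeometry.Motives

end
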